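import Literature.IUT.HodgeArakelov.BadPrimeGaussianMonoidsProofs4
import Literature.IUT.HodgeArakelov.BadPrimeGaussianMonoidsProofs5
import Literature.IUT.HodgeArakelov.BadPrimeGaussianMonoidsSyncProofs
import HarnessLib

/-!
# [IUTchII] Cor 3.5 (ii) "⥤": diagonal `G_v,⟨F_l^⋇⟩`-stability of `Ψ_ξ` and Galois equivariance of the REPAIRED
# restriction isomorphism `Ψ^ι_env ⥲ Ψ_ξ` (restriction OUT OF THE THETA MONOID), with conjugate synchronization of
# the constants DISCHARGED from Prop 3.1 (ii) — monoid-sourced sequel to `BadPrimeGaussianMonoidsSyncProofs.lean`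

S. Mochizuki, *Inter-universal Teichmüller theory II*, §3, kurims Dec-2020 manuscript, Cor 3.5 (ii) p. 95:
"each `Ψ_ξ(M^Θ_*)` is equipped with a natural action by `G_v(M^Θ_*▶)_{⟨F_l^⋇⟩}`" and "the compatibility of the
action of `G_v(M^Θ_*▶)_{|t|}` on the factor labeled `|t|` … with the inclusions `G_v(M^Θ_*) ↪ Π_{v▶}(M^Θ_*▶)`
determined by the various choices of the `D^δ_{t,μ_-}`"; Remark 3.6.1 p. 101: this "«Galois compatibility» …
corresponds precisely to the «Galois functoriality»" [cite: Mochizuki2012, Cor 3.5 (ii) p.95]. Claim key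
DISPUTED (D-0012). PROOF-ONLY companion (abc-iut cell, layer L6, seat abc-iut-w5-d100; sub-DAG
`plan/L6/SUBDAG-IUTchII-Cor-35.md` row Cor-35.ii.r10, optional item "monoid-sourced `restrictionIso'_equivariant`");
NO definition, NO `Prop` fact.

WHY THIS FILE. `BadPrimeGaussianMonoidsProofs3.pi_conj_eq_piIso` / `map_pi_diagonalStable` /
`restrictionIso_equivariant` and `BadPrimeGaussianMonoidsSyncProofs.map_pi_diagonalStable_of_kummer(_of_fixed)`
type the restriction morphisms OUT OF THE AMBIENT GROUP, `r_t : H →* M`. After RQ7 finding d017-F1-1 the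
restriction ISOMORPHISM of record is the monoid-sourced one of `BadPrimeGaussianMonoidsProofs4`
(`exists_restrictionIso'`, `exists_unique_restrictionIso'_thetaMonoid`: `r_t : M^×_TM · θ^ℕ →* M`, so that the theta
value may restrict to a NON-unit). The submonoid-sourced Galois SCHEMA is in the tree twice, landed while this file
was being written (abc-iut-w5-d086 `restrictionIso'_equivariant`, Proofs5 p414617 — USED BELOW BY NAME; abc-iut-w5-d031
`pi_conj_eq_piIso'` / `map_pi_diagonalStable'` / `mrange_pi_diagonalStable`, GaloisMonoidProofs p414646, typed with an
action on the source monoid). What is NOT in the tree and is supplied here is the monoid-sourced twin of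
`SyncProofs` §3 — the ASSEMBLY at `S = M^×_TM · θ^ℕ` with the constant half of conjugate synchronization DISCHARGED:

* `pi_conj_eq_piIso_submonoid`, `mrange_pi_diagonalStable_submonoid` — the schema for restriction morphisms
  `r_t : S →* M` out of a conjugation-stable submonoid `S ⊆ H` (stability `hstab` as a hypothesis, no action datum
  on the source; the `mrange` form is the one `exists_restrictionIso'` consumes) — two short lemmas kept here so the
  assembly below is self-contained over the Proofs4 typing; the equivariance-of-the-isomorphism conclusion is
  abc-iut-w5-d086's `restrictionIso'_equivariant` (cited, not restated);
* `thetaSplit_conjStable_of_kummer` — `M^×_TM · θ^ℕ` is stable under the `s_t(g)`, from the Kummer data of Prop 3.1 (ii)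
  (abc-iut-w4-d019 `units_conjStable_of_kummer`) and "`s_t(g)` moves `θ` within its `M^×_TM`-orbit";
* `mrange_pi_diagonalStable'_of_kummer(_of_fixed)` — **"each `Ψ_ξ(M^Θ_*)` is equipped with a natural action by
  `G_v(M^Θ_*▶)_{⟨F_l^⋇⟩}`" for the REPAIRED typing**, with conjugate synchronization of the CONSTANTS DISCHARGED
  (`sync_units_of_sections`) and the `θ`-hypotheses in the natural form `hfix` (the `s_t(g) ∈ D^δ_{t,μ_-} ⊆ Π_Ÿ` FIX
  the class `θ`: Cor 2.4 (ii)(c) + triviality of inner automorphisms on `H¹(Π_Ÿ,−)`) — leaving exactly the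
  equivariance `hr` and `hfix` as named hypotheses, as in `SyncProofs`;
* `restrictionIso'_equivariant_of_kummer_of_fixed` — Remark 3.6.1's Galois functoriality of the restriction
  ISOMORPHISM of record under the same discharged hypotheses (via Proofs5 `restrictionIso'_equivariant`).

Nothing here asserts a disputed claim or takes a side on [IUTchIII] Cor 3.12; typed ≠ proved ≠ endorsed.
-/

namespace Literature.IUT.HodgeArakelov

namespace BadPrimeGaussianMonoids

open TemperedThetaMonoids

universe u v w

/-! ### 1. Restriction out of a conjugation-stable submonoid: equivariance and diagonal stability -/

section Galois

variable {H : Type u} [CommGroup H] {T : Type v} {M : Type w} [CommMonoid M]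
  {G : Type*} [Group G] {P : Type*} [Group P]
  (conj : P →* MulAut H) (s : T → (G →* P)) (β : G →* MulAut M) (S : Submonoid H)
  (hstab : ∀ g t, ∀ x ∈ S, conj (s t g) x ∈ S) (r : T → (S →* M))

/-- **IUTchII:Cor3.5(ii)** (kurims p.95) "⥤", monoid-sourced: if each restriction `r_t : S → Ψ_cns,|t|` is
equivariant along the inclusion `s_t : G_v ↪ Π_X` it was restricted along, and the resulting actions AGREE on
`S` (conjugate synchronization), then the product restriction intertwines the action through `s_{t₀}` with the
DIAGONAL action `G_v,⟨F_l^⋇⟩` on the labeled copies. [cite: Mochizuki2012, Cor 3.5 (ii) p.95] -/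
theorem pi_conj_eq_piIso_submonoid
    (hr : ∀ t g (x : S), r t ⟨conj (s t g) x, hstab g t x x.2⟩ = β g (r t x))
    (hsync : ∀ g t t', ∀ x ∈ S, conj (s t g) x = conj (s t' g) x) (t₀ : T) (g : G) (x : S) :
    MonoidHom.pi r ⟨conj (s t₀ g) x, hstab g t₀ x x.2⟩ = piIso T (β g) (MonoidHom.pi r x) := by
  funext t
  have hx : (⟨conj (s t₀ g) x, hstab g t₀ x x.2⟩ : S) = ⟨conj (s t g) x, hstab g t x x.2⟩ :=
    Subtype.ext (hsync g t₀ t x x.2)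
  rw [MonoidHom.pi_apply, hx, hr]
  rfl

/-- **IUTchII:Cor3.5(ii)** (kurims p.95) "each `Ψ_ξ(M^Θ_*)` is equipped with a natural action by
`G_v(M^Θ_*▶)_{⟨F_l^⋇⟩}`", monoid-sourced: the IMAGE `r(S)` — the Gaussian monoid `Ψ_ξ` when `S = M^×_TM · θ^ℕ`
(`mrange_pi_eq_gaussianMonoid`, Proofs4) — is stable under the diagonal action.
[cite: Mochizuki2012, Cor 3.5 (ii) p.95] -/
theorem mrange_pi_diagonalStable_submonoid
    (hr : ∀ t g (x : S), r t ⟨conj (s t g) x, hstab g t x x.2⟩ = β g (r t x))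
    (hsync : ∀ g t t', ∀ x ∈ S, conj (s t g) x = conj (s t' g) x) (t₀ : T) (g : G) :
    (MonoidHom.mrange (MonoidHom.pi r)).map (piIso T (β g)).toMonoidHom = MonoidHom.mrange (MonoidHom.pi r) := by
  apply le_antisymm
  · rintro _ ⟨_, ⟨x, rfl⟩, rfl⟩
    exact ⟨⟨conj (s t₀ g) x, hstab g t₀ x x.2⟩, pi_conj_eq_piIso_submonoid conj s β S hstab r hr hsync t₀ g x⟩
  · rintro _ ⟨x, rfl⟩
    refine ⟨MonoidHom.pi r ⟨conj (s t₀ g⁻¹) x, hstab g⁻¹ t₀ x x.2⟩, ⟨_, rfl⟩, ?_⟩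
    rw [MulEquiv.coe_toMonoidHom, pi_conj_eq_piIso_submonoid conj s β S hstab r hr hsync t₀ g⁻¹ x, map_inv]
    exact (piIso T (β g)).apply_symm_apply _

end Galois

/-! ### 2. The same for `Ψ^ι_env = M^×_TM · θ^ℕ` with the constant half of conjugate synchronization
discharged from Prop 3.1 (ii) -/

section Assembly

variable {S : ThetaSetting.{u}} (A : AbsTopMonoids S) (Pc : IsoClass S.PiX)
  (E : TemperedThetaMonoids.ThetaEnvData.{u, v} Pc.G) (κ : A.MTM Pc →* E.H)
  {G : Type w} [Group G] {T : Type*} {M : Type*} [CommMonoid M]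

/-- Stability of `M^×_TM · θ^ℕ` under the elements `s_t(g)`, from the Kummer data of Prop 3.1 (ii) (units are
stable: abc-iut-w4-d019 `units_conjStable_of_kummer`) and "`s_t(g)` moves `θ` within its `M^×_TM`-orbit"
(`SyncProofs.splitMonoid_conjStable`). [cite: Mochizuki2012, Cor 3.5 (ii) p.95] -/
theorem thetaSplit_conjStable_of_kummer (hcns : E.constantMonoid = MonoidHom.mrange κ)
    (hκeq : ∀ (x : Pc.G) (m : A.MTM Pc), κ (A.actMTM Pc x m) = E.conj x (κ m)) (s : T → (G →* Pc.G))
    (θ : E.H) (hθU : ∀ g t, ∃ u ∈ E.units, E.conj (s t g) θ = u * θ) (g : G) (t : T) :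
    ∀ x ∈ splitMonoid E.units (Submonoid.powers θ), E.conj (s t g) x ∈ splitMonoid E.units (Submonoid.powers θ) :=
  fun x hx => splitMonoid_conjStable E.conj E.units θ (s t g)
    (fun u hu => units_conjStable_of_kummer A Pc E κ hcns hκeq (s t g) u hu) (hθU g t) x hx

/-- **IUTchII:Cor3.5(ii)** (kurims p.95) "each `Ψ_ξ(M^Θ_*)` is equipped with a natural action by
`G_v(M^Θ_*▶)_{⟨F_l^⋇⟩}`", for `Ψ^ι_env = M^×_TM · θ^ℕ` and restriction morphisms OUT OF THE THETA MONOID (the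
d017-F1-1 typing of Proofs4): the image `Ψ_ξ` is stable under the DIAGONAL action, given (a) the Kummer data of
Prop 3.1 (ii), (b) sections `s_t : G_v → Π_X(M^Θ_*)` agreeing modulo `Δ`, (c) restrictions equivariant along
the `s_t`, and on the ONE class `θ`: (d) synchronization and (e) `conj (s_t g) θ ∈ M^×_TM · θ`; the constant
half of conjugate synchronization and the stability of the units are PROVED from (a).
[cite: Mochizuki2012, Cor 3.5 (ii) p.95] -/
theorem mrange_pi_diagonalStable'_of_kummer (hκ : Function.Injective κ)
    (hcns : E.constantMonoid = MonoidHom.mrange κ)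
    (hκeq : ∀ (x : Pc.G) (m : A.MTM Pc), κ (A.actMTM Pc x m) = E.conj x (κ m)) (s : T → (G →* Pc.G))
    (hs : ∀ t t' g, (QuotientGroup.mk (s t g) : Pc.G ⧸ A.Delta Pc) = QuotientGroup.mk (s t' g))
    (β : G →* MulAut M) (θ : E.H) (hθ : ∀ g t t', E.conj (s t g) θ = E.conj (s t' g) θ)
    (hθU : ∀ g t, ∃ u ∈ E.units, E.conj (s t g) θ = u * θ)
    (r : T → (splitMonoid E.units (Submonoid.powers θ) →* M))
    (hr : ∀ t g (x : splitMonoid E.units (Submonoid.powers θ)),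
      r t ⟨E.conj (s t g) x, thetaSplit_conjStable_of_kummer A Pc E κ hcns hκeq s θ hθU g t x x.2⟩ =
        β g (r t x)) (t₀ : T) (g : G) :
    (MonoidHom.mrange (MonoidHom.pi r)).map (piIso T (β g)).toMonoidHom = MonoidHom.mrange (MonoidHom.pi r) :=
  mrange_pi_diagonalStable_submonoid E.conj s β _ (thetaSplit_conjStable_of_kummer A Pc E κ hcns hκeq s θ hθU) r hr
    (sync_splitMonoid E.conj s E.units θ (sync_units_of_sections A Pc E κ hκ hcns hκeq s hs) hθ) t₀ g

/-- Fixing the class: if every `s_t(g)` FIXES `θ` (in print: `D^δ_{t,μ_-} ⊆ Π_Ÿ(M^Θ_*)`, Cor 2.4 (ii)(c), and inner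
automorphisms of `Π_Ÿ` act trivially on `H¹(Π_Ÿ,−)`), then hypotheses (d), (e) of
`mrange_pi_diagonalStable'_of_kummer` hold. [cite: Mochizuki2012, Cor 3.5 (ii) p.95] -/
theorem theta_orbit_of_fixed (s : T → (G →* Pc.G)) (θ : E.H) (hfix : ∀ g t, E.conj (s t g) θ = θ) :
    (∀ g t t', E.conj (s t g) θ = E.conj (s t' g) θ) ∧ ∀ g t, ∃ u ∈ E.units, E.conj (s t g) θ = u * θ :=
  ⟨fun g t t' => by rw [hfix, hfix], fun g t => ⟨1, E.units.one_mem, by rw [hfix, one_mul]⟩⟩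

/-- **IUTchII:Cor3.5(ii)** (kurims p.95), diagonal `G_v,⟨F_l^⋇⟩`-stability of `Ψ_ξ` for the monoid-sourced
restrictions, with the `θ`-hypotheses in their natural form `hfix` (the `s_t(g)` fix the class `θ`); residual
named hypotheses: the equivariance `hr` and `hfix`. [cite: Mochizuki2012, Cor 3.5 (ii) p.95] -/
theorem mrange_pi_diagonalStable'_of_kummer_of_fixed (hκ : Function.Injective κ)
    (hcns : E.constantMonoid = MonoidHom.mrange κ)
    (hκeq : ∀ (x : Pc.G) (m : A.MTM Pc), κ (A.actMTM Pc x m) = E.conj x (κ m)) (s : T → (G →* Pc.G))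
    (hs : ∀ t t' g, (QuotientGroup.mk (s t g) : Pc.G ⧸ A.Delta Pc) = QuotientGroup.mk (s t' g))
    (β : G →* MulAut M) (θ : E.H) (hfix : ∀ g t, E.conj (s t g) θ = θ)
    (r : T → (splitMonoid E.units (Submonoid.powers θ) →* M))
    (hr : ∀ t g (x : splitMonoid E.units (Submonoid.powers θ)),
      r t ⟨E.conj (s t g) x, thetaSplit_conjStable_of_kummer A Pc E κ hcns hκeq s θ
        (theta_orbit_of_fixed Pc E s θ hfix).2 g t x x.2⟩ = β g (r t x)) (t₀ : T) (g : G) :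
    (MonoidHom.mrange (MonoidHom.pi r)).map (piIso T (β g)).toMonoidHom = MonoidHom.mrange (MonoidHom.pi r) :=
  mrange_pi_diagonalStable'_of_kummer A Pc E κ hκ hcns hκeq s hs β θ (theta_orbit_of_fixed Pc E s θ hfix).1
    (theta_orbit_of_fixed Pc E s θ hfix).2 r hr t₀ g

/-- **IUTchII:Rmk3.6.1** (kurims p.101) Galois functoriality of the restriction ISOMORPHISM of record
(`exists_restrictionIso'`, restriction OUT OF THE THETA MONOID): any `e : M^×_TM · θ^ℕ ⥲ Ψ_ξ` pinned to the
restriction is `G_v`-equivariant (action through `s_{t₀}` on the source, diagonal action on `Ψ_ξ`), under the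
Kummer data of Prop 3.1 (ii), sections agreeing mod `Δ`, equivariant restrictions and `hfix`.
[cite: Mochizuki2012, Rmk 3.6.1 p.101] -/
theorem restrictionIso'_equivariant_of_kummer_of_fixed (hκ : Function.Injective κ)
    (hcns : E.constantMonoid = MonoidHom.mrange κ)
    (hκeq : ∀ (x : Pc.G) (m : A.MTM Pc), κ (A.actMTM Pc x m) = E.conj x (κ m)) (s : T → (G →* Pc.G))
    (hs : ∀ t t' g, (QuotientGroup.mk (s t g) : Pc.G ⧸ A.Delta Pc) = QuotientGroup.mk (s t' g))
    (β : G →* MulAut M) (θ : E.H) (hfix : ∀ g t, E.conj (s t g) θ = θ)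
    (r : T → (splitMonoid E.units (Submonoid.powers θ) →* M))
    (hr : ∀ t g (x : splitMonoid E.units (Submonoid.powers θ)),
      r t ⟨E.conj (s t g) x, thetaSplit_conjStable_of_kummer A Pc E κ hcns hκeq s θ
        (theta_orbit_of_fixed Pc E s θ hfix).2 g t x x.2⟩ = β g (r t x))
    {S' : Submonoid (T → M)} (e : splitMonoid E.units (Submonoid.powers θ) ≃* S')
    (he : ∀ x, ((e x : S') : T → M) = MonoidHom.pi r x) (t₀ : T) (g : G)
    (x : splitMonoid E.units (Submonoid.powers θ)) :
    ((e ⟨E.conj (s t₀ g) x, thetaSplit_conjStable_of_kummer A Pc E κ hcns hκeq s θ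
        (theta_orbit_of_fixed Pc E s θ hfix).2 g t₀ x x.2⟩ : S') : T → M) = piIso T (β g) (e x : T → M) :=
  restrictionIso'_equivariant E.conj s β _ r
    (thetaSplit_conjStable_of_kummer A Pc E κ hcns hκeq s θ (theta_orbit_of_fixed Pc E s θ hfix).2) hr
    (sync_splitMonoid E.conj s E.units θ (sync_units_of_sections A Pc E κ hκ hcns hκeq s hs)
      (theta_orbit_of_fixed Pc E s θ hfix).1) e he t₀ g x

end Assembly

end BadPrimeGaussianMonoids

end Literature.IUT.HodgeArakelov
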